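import Literature.MathematicalPhysics.QuantumLattice.TorusCooperSum
import HarnessLib

/-!
# Localisation of the canonical Fermi level of the free torus band

Topic `MathematicalPhysics/QuantumLattice`. For the canonical shell level
`μ_L(N) = torusFermiLevel L N` of `TorusCooperSum.lean` (the energy of the shell holding the
`N`-th electron of the free Fermi sea on the `L × L` torus, band `ε_L(k) = -2Σᵢcos(2πkᵢ/L) ∈
[-4, 4]`) this file PROVES that fillings bounded away from the empty and the full band keep the
shell level away from the band edges:

* `abs_le_of_cos_ge` — `cos x ≥ 1 - s²/2`, `|x| ≤ π` force `|x| ≤ πs/2`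
  (Mathlib's `Real.cos_le_one_sub_mul_cos_sq`: `cos x ≤ 1 - 2x²/π²`);
* `card_filter_cos_ge_le`, `card_filter_cos_le_le` — at most `sL/2 + 2` momenta `n ∈ ℤ/Lℤ`
  have `cos(2πn/L) ≥ 1 - s²/2`, resp. `≤ -1 + s²/2`;
* `torusLevelCount_bottom_le`, `sq_sub_torusLevelCount_top_le` — hence at most `(sL/2 + 2)²`
  momenta of `(ℤ/Lℤ)²` lie below `-4 + s²`, resp. above `4 - s²`;
* `torusFermiLevel_mem_Icc` — **for `θL² ≤ N ≤ (2 - θ)L²` and `θL² ≥ 18`,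
  `μ_L(N) ∈ [-4 + θ²/16, 4 - θ²/16]`**.

Used by `TorusCooperSumLogBound.lean` (the `log L` lower bound for the torus Cooper sum). The
constants are not optimised.

## References

* G. Benfatto, A. Giuliani, V. Mastropietro, Ann. Henri Poincaré 7 (2006) 809, eq. (1.4) (the
  band). [BenfattoGiulianiMastropietro2006]
-/

noncomputable section

open Finset
open Literature.Probability.LatticeModels

namespace Literature.MathematicalPhysics.QuantumLattice

/-! ### One-dimensional counts near `cos = ±1` -/

section FermiLocalisation

open Real

variable {L : ℕ} [NeZero L]

/-- `cos x ≥ 1 - s²/2` and `|x| ≤ π` force `|x| ≤ πs/2` (from `cos x ≤ 1 - 2x²/π²`). [folklore] -/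
theorem abs_le_of_cos_ge {s x : ℝ} (hs : 0 ≤ s) (hx : |x| ≤ π)
    (h : 1 - s ^ 2 / 2 ≤ Real.cos x) : |x| ≤ π * s / 2 := by
  have h1 := Real.cos_le_one_sub_mul_cos_sq hx
  have hπ := Real.pi_pos
  have h2 : x ^ 2 ≤ (π * s / 2) ^ 2 := by
    have h3 : 2 / π ^ 2 * x ^ 2 ≤ s ^ 2 / 2 := by linarith
    rw [div_mul_eq_mul_div, div_le_iff₀ (by positivity)] at h3
    have h4 : (π * s / 2) ^ 2 = s ^ 2 / 2 * π ^ 2 / 2 := by ring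
    rw [h4]
    linarith
  exact abs_le_of_sq_le_sq h2 (by positivity)

omit [NeZero L] in
/-- A momentum `p = 2πv/L`, `v < L`, with `cos p ≥ 1 - s²/2` is within `sL/4` grid steps of
`0` or of `L`. [folklore] -/
theorem val_le_or_sub_le_of_cos_ge {s : ℝ} (hs : 0 ≤ s) (hL : 0 < L) {v : ℕ} (hv : v < L)
    (h : 1 - s ^ 2 / 2 ≤ Real.cos (2 * π * v / L)) :
    (v : ℝ) ≤ s * L / 4 ∨ (L : ℝ) - v ≤ s * L / 4 := by
  have hπ := Real.pi_pos
  have hLr : (0 : ℝ) < L := by exact_mod_cast hL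
  by_cases hvL : 2 * (v : ℝ) ≤ L
  · left
    have hx : |2 * π * v / L| ≤ π := by
      rw [abs_of_nonneg (by positivity), div_le_iff₀ hLr]
      nlinarith
    have := abs_le_of_cos_ge hs hx h
    rw [abs_of_nonneg (by positivity), div_le_iff₀ hLr] at this
    nlinarith
  · right
    push Not at hvL
    have hx : |2 * π * v / L - 2 * π| ≤ π := by
      have hvL' : (v : ℝ) ≤ L := by exact_mod_cast hv.le
      have h1 : π ≤ 2 * π * v / L := by
        rw [le_div_iff₀ hLr]
        nlinarith
      have h2 : 2 * π * v / L ≤ 2 * π := by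
        rw [div_le_iff₀ hLr]
        nlinarith
      rw [abs_le]
      constructor <;> linarith
    have hcos : Real.cos (2 * π * v / L - 2 * π) = Real.cos (2 * π * v / L) := Real.cos_sub_two_pi _
    have := abs_le_of_cos_ge hs hx (hcos ▸ h)
    rw [abs_le] at this
    have h1 := this.1
    rw [neg_le_sub_iff_le_add, div_add' _ _ _ hLr.ne', le_div_iff₀ hLr] at h1
    nlinarith

omit [NeZero L] in
/-- A momentum `p = 2πv/L`, `v < L`, with `cos p ≤ -1 + s²/2` is within `sL/4` grid steps of
`L/2`. [folklore] -/
theorem abs_sub_le_of_cos_le {s : ℝ} (hs : 0 ≤ s) (hL : 0 < L) {v : ℕ} (hv : v < L)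
    (h : Real.cos (2 * π * v / L) ≤ -1 + s ^ 2 / 2) :
    |(L : ℝ) - 2 * v| ≤ s * L / 2 := by
  have hπ := Real.pi_pos
  have hLr : (0 : ℝ) < L := by exact_mod_cast hL
  have hvL' : (v : ℝ) ≤ L := by exact_mod_cast hv.le
  have hx : |2 * π * v / L - π| ≤ π := by
    rw [abs_le]
    constructor
    · have : 0 ≤ 2 * π * v / L := by positivity
      linarith
    · rw [sub_le_iff_le_add, div_le_iff₀ hLr]
      nlinarith
  have hcos : Real.cos (2 * π * v / L - π) = -Real.cos (2 * π * v / L) := Real.cos_sub_pi _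
  have h' : 1 - s ^ 2 / 2 ≤ Real.cos (2 * π * v / L - π) := by rw [hcos]; linarith
  have := abs_le_of_cos_ge hs hx h'
  have hL0 : (L : ℝ) ≠ 0 := hLr.ne'
  have hmul : |2 * π * v / L - π| * L = π * |(L : ℝ) - 2 * v| := by
    have e : (2 * π * v / L - π) * L = π * (2 * v - L) := by field_simp
    calc |2 * π * v / L - π| * L = |(2 * π * v / L - π) * L| := by rw [abs_mul, abs_of_pos hLr]
      _ = π * |(2 : ℝ) * v - L| := by rw [e, abs_mul, abs_of_pos hπ]
      _ = π * |(L : ℝ) - 2 * v| := by rw [abs_sub_comm]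
  have h2 : |2 * π * v / L - π| * L ≤ π * s / 2 * L := by gcongr
  rw [hmul] at h2
  nlinarith [abs_nonneg ((L : ℝ) - 2 * v)]

/-- At most `sL/2 + 2` momenta of `ℤ/Lℤ` have `cos(2πn/L) ≥ 1 - s²/2`. [folklore] -/
theorem card_filter_cos_ge_le {s : ℝ} (hs : 0 ≤ s) :
    ((univ.filter fun n : ZMod L => 1 - s ^ 2 / 2 ≤ Real.cos (2 * π * n.val / L)).card : ℝ) ≤
      s * L / 2 + 2 := by
  classical
  have hL : 0 < L := Nat.pos_of_ne_zero (NeZero.ne L)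
  set M : ℕ := ⌊s * L / 4⌋₊ with hM
  set A : Finset (ZMod L) := (range (M + 1)).image fun j : ℕ => (j : ZMod L) with hA
  set B : Finset (ZMod L) := (range (M + 1)).image fun j : ℕ => ((L - 1 - j : ℕ) : ZMod L) with hB
  have hsub : (univ.filter fun n : ZMod L => 1 - s ^ 2 / 2 ≤ Real.cos (2 * π * n.val / L)) ⊆
      A ∪ B := by
    intro n hn
    rw [mem_filter] at hn
    rw [mem_union]
    have hv : n.val < L := ZMod.val_lt n
    rcases val_le_or_sub_le_of_cos_ge hs hL hv hn.2 with h | h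
    · left
      rw [hA, mem_image]
      refine ⟨n.val, ?_, ZMod.natCast_zmod_val n⟩
      rw [mem_range, Nat.lt_add_one_iff, hM, Nat.le_floor_iff (by positivity)]
      exact h
    · right
      rw [hB, mem_image]
      refine ⟨L - 1 - n.val, ?_, ?_⟩
      · rw [mem_range, Nat.lt_add_one_iff, hM, Nat.le_floor_iff (by positivity)]
        have : ((L - 1 - n.val : ℕ) : ℝ) = L - 1 - n.val := by
          rw [Nat.cast_sub (by omega), Nat.cast_sub (by omega), Nat.cast_one]
        rw [this]
        linarith
      · have : L - 1 - (L - 1 - n.val) = n.val := by omega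
        rw [this, ZMod.natCast_zmod_val]
  calc ((univ.filter fun n : ZMod L => 1 - s ^ 2 / 2 ≤ Real.cos (2 * π * n.val / L)).card : ℝ)
      ≤ ((A ∪ B).card : ℝ) := by exact_mod_cast card_le_card hsub
    _ ≤ (A.card : ℝ) + B.card := by exact_mod_cast card_union_le A B
    _ ≤ (M + 1 : ℝ) + (M + 1) := by
        gcongr
        · exact_mod_cast (card_image_le.trans (card_range _).le)
        · exact_mod_cast (card_image_le.trans (card_range _).le)
    _ ≤ s * L / 2 + 2 := by
        have : (M : ℝ) ≤ s * L / 4 := Nat.floor_le (by positivity)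
        linarith

/-- At most `sL/2 + 2` momenta of `ℤ/Lℤ` have `cos(2πn/L) ≤ -1 + s²/2`. [folklore] -/
theorem card_filter_cos_le_le {s : ℝ} (hs : 0 ≤ s) :
    ((univ.filter fun n : ZMod L => Real.cos (2 * π * n.val / L) ≤ -1 + s ^ 2 / 2).card : ℝ) ≤
      s * L / 2 + 2 := by
  classical
  have hL : 0 < L := Nat.pos_of_ne_zero (NeZero.ne L)
  set M : ℕ := ⌊s * L / 2⌋₊ with hM
  set c : ℕ := ⌈((L : ℝ) - s * L / 2) / 2⌉₊ with hc
  set A : Finset (ZMod L) := (range (M + 1)).image fun j : ℕ => ((c + j : ℕ) : ZMod L) with hA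
  have hsub : (univ.filter fun n : ZMod L => Real.cos (2 * π * n.val / L) ≤ -1 + s ^ 2 / 2) ⊆
      A := by
    intro n hn
    rw [mem_filter] at hn
    have hv : n.val < L := ZMod.val_lt n
    have h := abs_sub_le_of_cos_le hs hL hv hn.2
    rw [abs_le] at h
    rw [hA, mem_image]
    -- `c ≤ n.val ≤ c + M`
    have hc1 : (c : ℝ) ≤ n.val := by
      have h3 : ((L : ℝ) - s * L / 2) / 2 ≤ n.val := by linarith [h.2]
      -- `c` is the least integer above, `n.val` is an integer above
      have h4 : c ≤ n.val := by
        rw [hc, Nat.ceil_le]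
        exact h3
      exact_mod_cast h4
    have hc2 : (n.val : ℝ) ≤ c + M := by
      have h5 : ((L : ℝ) - s * L / 2) / 2 ≤ c := Nat.le_ceil _
      have h6 : (n.val : ℝ) - c ≤ s * L / 2 := by linarith [h.1]
      have h7 : ((n.val - c : ℕ) : ℝ) ≤ M := by
        rw [hM]
        have h8 : n.val - c ≤ ⌊s * L / 2⌋₊ := by
          rw [Nat.le_floor_iff (by positivity), Nat.cast_sub (by exact_mod_cast hc1)]
          exact h6
        exact_mod_cast h8
      rw [Nat.cast_sub (by exact_mod_cast hc1)] at h7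
      linarith
    refine ⟨n.val - c, ?_, ?_⟩
    · rw [mem_range, Nat.lt_add_one_iff]
      have : ((n.val - c : ℕ) : ℝ) ≤ M := by
        rw [Nat.cast_sub (by exact_mod_cast hc1)]; linarith
      exact_mod_cast this
    · have : c + (n.val - c) = n.val := by
        have : c ≤ n.val := by exact_mod_cast hc1
        omega
      rw [this, ZMod.natCast_zmod_val]
  calc ((univ.filter fun n : ZMod L => Real.cos (2 * π * n.val / L) ≤ -1 + s ^ 2 / 2).card : ℝ)
      ≤ (A.card : ℝ) := by exact_mod_cast card_le_card hsub
    _ ≤ (M + 1 : ℝ) := by exact_mod_cast (card_image_le.trans (card_range _).le)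
    _ ≤ s * L / 2 + 2 := by
        have : (M : ℝ) ≤ s * L / 2 := Nat.floor_le (by positivity)
        linarith

end FermiLocalisation

section FermiLocalisation2

open Real

variable {L : ℕ} [NeZero L]

/-- Near the bottom of the band: `#{k | ε_L(k) ≤ -4 + s²} ≤ (sL/2 + 2)²` (both `cos(2πkᵢ/L)`
must be `≥ 1 - s²/2`). [folklore] -/
theorem torusLevelCount_bottom_le {s : ℝ} (hs : 0 ≤ s) :
    (torusLevelCount L (-4 + s ^ 2) : ℝ) ≤ (s * L / 2 + 2) ^ 2 := by
  classical
  set S : Finset (ZMod L) :=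
    univ.filter fun n : ZMod L => 1 - s ^ 2 / 2 ≤ Real.cos (2 * π * n.val / L) with hS
  have hsub : (univ.filter fun k : TorusSite 2 L => torusBand L k ≤ -4 + s ^ 2) ⊆
      Fintype.piFinset fun _ : Fin 2 => S := by
    intro k hk
    simp only [mem_filter, mem_univ, true_and] at hk
    rw [Fintype.mem_piFinset]
    unfold torusBand at hk
    rw [Fin.sum_univ_two] at hk
    simp only [latticeMomentum] at hk
    have h0 := Real.cos_le_one (2 * π * ((k 0).val : ℝ) / L)
    have h1 := Real.cos_le_one (2 * π * ((k 1).val : ℝ) / L)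
    intro i
    fin_cases i
    · simp only [hS, mem_filter, mem_univ, true_and, Fin.zero_eta]
      linarith
    · simp only [hS, mem_filter, mem_univ, true_and, Fin.mk_one]
      linarith
  calc (torusLevelCount L (-4 + s ^ 2) : ℝ)
      ≤ ((Fintype.piFinset fun _ : Fin 2 => S).card : ℝ) := by
        rw [torusLevelCount_def]; exact_mod_cast card_le_card hsub
    _ = (S.card : ℝ) ^ 2 := by rw [Fintype.card_piFinset, Fin.prod_const]; push_cast; ring
    _ ≤ (s * L / 2 + 2) ^ 2 := by
        gcongr
        exact card_filter_cos_ge_le hs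

/-- Near the top of the band: `#{k | ε_L(k) > 4 - s²} ≤ (sL/2 + 2)²`, stated as
`L² - #{ε_L ≤ 4 - s²} ≤ (sL/2 + 2)²`. [folklore] -/
theorem sq_sub_torusLevelCount_top_le {s : ℝ} (hs : 0 ≤ s) :
    (L : ℝ) ^ 2 - torusLevelCount L (4 - s ^ 2) ≤ (s * L / 2 + 2) ^ 2 := by
  classical
  set S : Finset (ZMod L) :=
    univ.filter fun n : ZMod L => Real.cos (2 * π * n.val / L) ≤ -1 + s ^ 2 / 2 with hS
  have hsub : (univ.filter fun k : TorusSite 2 L => torusBand L k ≤ 4 - s ^ 2)ᶜ ⊆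
      Fintype.piFinset fun _ : Fin 2 => S := by
    intro k hk
    rw [mem_compl, mem_filter, not_and] at hk
    have hk' := hk (mem_univ k)
    rw [not_le] at hk'
    rw [Fintype.mem_piFinset]
    unfold torusBand at hk'
    rw [Fin.sum_univ_two] at hk'
    simp only [latticeMomentum] at hk'
    have h0 := Real.neg_one_le_cos (2 * π * ((k 0).val : ℝ) / L)
    have h1 := Real.neg_one_le_cos (2 * π * ((k 1).val : ℝ) / L)
    intro i
    fin_cases i
    · simp only [hS, mem_filter, mem_univ, true_and, Fin.zero_eta]
      linarith
    · simp only [hS, mem_filter, mem_univ, true_and, Fin.mk_one]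
      linarith
  have hcard : (((univ.filter fun k : TorusSite 2 L => torusBand L k ≤ 4 - s ^ 2)ᶜ).card : ℝ) =
      (L : ℝ) ^ 2 - torusLevelCount L (4 - s ^ 2) := by
    rw [card_compl, card_torusSite_two, torusLevelCount_def,
      Nat.cast_sub ((card_le_univ _).trans (card_torusSite_two L).le)]
    push_cast
    ring
  calc (L : ℝ) ^ 2 - torusLevelCount L (4 - s ^ 2)
      = (((univ.filter fun k : TorusSite 2 L => torusBand L k ≤ 4 - s ^ 2)ᶜ).card : ℝ) := hcard.symm
    _ ≤ ((Fintype.piFinset fun _ : Fin 2 => S).card : ℝ) := by exact_mod_cast card_le_card hsub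
    _ = (S.card : ℝ) ^ 2 := by rw [Fintype.card_piFinset, Fin.prod_const]; push_cast; ring
    _ ≤ (s * L / 2 + 2) ^ 2 := by
        gcongr
        exact card_filter_cos_le_le hs

/-- **Localisation of the canonical Fermi level.** If the filling stays away from the empty and
the full band, `θL² ≤ N ≤ (2 - θ)L²` with `θ > 0` (so `θ ≤ 1`), then for `θL² ≥ 18` the shell
level stays away from the band edges: `μ_L(N) ∈ [-4 + θ²/16, 4 - θ²/16]`. [folklore] -/
theorem torusFermiLevel_mem_Icc {θ : ℝ} (hθ : 0 < θ) (hL : 18 ≤ θ * (L : ℝ) ^ 2)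
    {N : ℕ} (hN1 : θ * (L : ℝ) ^ 2 ≤ N) (hN2 : (N : ℝ) ≤ (2 - θ) * (L : ℝ) ^ 2) :
    torusFermiLevel L N ∈ Set.Icc (-4 + θ ^ 2 / 16) (4 - θ ^ 2 / 16) := by
  have hLr : (0 : ℝ) < L := by exact_mod_cast Nat.pos_of_ne_zero (NeZero.ne L)
  have hθ1 : θ ≤ 1 := by nlinarith
  have hNpos : 0 < N := by
    have : (0 : ℝ) < N := lt_of_lt_of_le (by positivity) hN1
    exact_mod_cast this
  have hN2L : N ≤ 2 * L ^ 2 := by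
    have : (N : ℝ) ≤ 2 * (L : ℝ) ^ 2 := by nlinarith
    exact_mod_cast this
  -- the key numerical fact: `2 (θL/8 + 2)² < θ L²`
  have hL5 : (5 : ℝ) ≤ L := by
    by_contra h
    push Not at h
    have : (L : ℝ) ≤ 4 := by
      have : L < 5 := by exact_mod_cast h
      exact_mod_cast Nat.lt_succ_iff.mp this
    nlinarith
  have hkey : 2 * (θ / 4 * L / 2 + 2) ^ 2 < θ * (L : ℝ) ^ 2 := by
    have h1 : θ ^ 2 * (L : ℝ) ^ 2 ≤ θ * (L : ℝ) ^ 2 := by nlinarith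
    have h2 : θ * L * 5 ≤ θ * (L : ℝ) ^ 2 := by nlinarith
    nlinarith
  have hs : (0 : ℝ) ≤ θ / 4 := by positivity
  have hs2 : (θ / 4) ^ 2 = θ ^ 2 / 16 := by ring
  constructor
  · by_contra hlt
    push Not at hlt
    have h1 := le_two_mul_torusLevelCount_torusFermiLevel (L := L) hNpos hN2L
    have h2 : torusLevelCount L (torusFermiLevel L N) ≤ torusLevelCount L (-4 + (θ / 4) ^ 2) :=
      torusLevelCount_mono (by rw [hs2]; exact hlt.le)
    have h3 := torusLevelCount_bottom_le (L := L) hs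
    have h1' : (N : ℝ) ≤ 2 * torusLevelCount L (torusFermiLevel L N) := by exact_mod_cast h1
    have h2' : (torusLevelCount L (torusFermiLevel L N) : ℝ) ≤
        torusLevelCount L (-4 + (θ / 4) ^ 2) := by exact_mod_cast h2
    linarith
  · by_contra hlt
    push Not at hlt
    have h1 := two_mul_torusLevelCount_lt (L := L) hNpos hN2L (E := 4 - (θ / 4) ^ 2)
      (by rw [hs2]; exact hlt)
    have h3 := sq_sub_torusLevelCount_top_le (L := L) hs
    have h4 : 2 * ((L : ℝ) ^ 2 - (θ / 4 * L / 2 + 2) ^ 2) < N := by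
      calc 2 * ((L : ℝ) ^ 2 - (θ / 4 * L / 2 + 2) ^ 2)
          ≤ 2 * (torusLevelCount L (4 - (θ / 4) ^ 2) : ℝ) := by linarith
        _ < N := by exact_mod_cast h1
    nlinarith

end FermiLocalisation2

end Literature.MathematicalPhysics.QuantumLattice
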